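import Literature.AlgebraicGeometry.HodgeTheory.MotivatedGaloisGroup
import Literature.AlgebraicGeometry.HodgeTheory.HodgeGroupProductCMFactorClasses
import Literature.AlgebraicGeometry.HodgeTheory.HodgeTypeExteriorProduct
import Literature.AlgebraicGeometry.HodgeTheory.HardLefschetzThreefold
import Literature.AlgebraicGeometry.HodgeTheory.GysinFormalismHodgeOfGysin
import Literature.AlgebraicGeometry.HodgeTheory.HodgeRiemannPolarizabilityProofs
import Literature.AlgebraicGeometry.HodgeTheory.DivisorClassesHardLefschetz
import Literature.AlgebraicGeometry.Motives.SupersingularAbelianVariety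
import Literature.AlgebraicGeometry.Motives.AbelianVarietyProductDimProofs
import Literature.NumberTheory.Transcendental.DeRhamTheoremMultiplicative
import Literature.Barriers.HodgeConjecture.ExceptionalHodgeClasses
import HarnessLib

/-!
# The Lefschetz group `L(A)` of a complex abelian variety and Lefschetz classes on its powers, Tannaka-free (Milne 1999, Duke 96, §4)

Family `hodge`, layer `Literature/AlgebraicGeometry/Milne1999`, namespace
`Literature.AlgebraicGeometry.Milne1999` (D-0022). Written for the cell `pub-hodgecm2` (COR-CM,
Hodge ladder stage 2), literature fan-out plan `HOME/lit/LIT-FANOUT-PLAN.md` §B **INFRA-04**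
("Lefschetz group `L(A)`, Lefschetz classes, powers `A^r`; Milne 1999a records"; binder table
`HOME/lit/milne.md` rows M1, M4, M5: "not typed: needs `Hg(A)`, `L(A)` as algebraic groups on
powers"). Source read (held text `paper:doi-10-1215-s0012-7094-99-09620-5`, author version
1999aP, 31 pp. = Duke Math. J. 96 (1999) 639–675), verbatim:

* Introduction (p. 639; held p0001): "we define `D_∼(X)` to be the `ℚ`-subalgebra of `C_∼(X)`
  generated by the divisor classes: `D_∼(X) = ℚ[C¹_∼(X)]`. The elements of `D_∼(X)` will be called the
  *Lefschetz classes* on `X` (for the relation `∼`). They are the algebraic classes on `X` expressible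
  as linear combinations of intersections of divisor classes (including the empty intersection, `X`).
  Our main theorem states that, for any Weil cohomology theory `X ↦ H^*(X)` and any abelian variety
  `A` over an algebraically closed field, there is a reductive algebraic group `L(A)` (not necessarily
  connected) such that the cycle class map induces an isomorphism
  `D^s_hom(A^r) ⊗_ℚ k → H^{2s}(A^r)(s)^{L(A)}` for all integers `r, s ≥ 0`".
* §4, p. 657–658 (held p0019–p0020): "We define `D_hom(X)_k` to be the `k`-subspace of `H^{2*}(X)(*)`
  spanned by the image of the cycle class map `cl : D_rat(X) → H^{2*}(X)(*)`."
* **Definition 4.3** (p. 659; held p0021 L1–L4): "The Lefschetz group `L(A)` of an abelian variety `A`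
  over `Ω` is the largest algebraic subgroup of `GL(V(A)) × 𝔾_m/k` fixing the elements of
  `D^s_hom(A^r)_k ⊂ H^{2s}(A^r)(s)` for all `r, s`."
* **Theorem 4.4** (ibid.): "The map `γ ↦ (γ, γ†γ) : G(A) → GL(V(A)) × 𝔾_m` sends `G(A)`
  isomorphically onto `L(A)`" (`G(A)(R) = {γ ∈ C(A) ⊗ R | γ†γ ∈ R^×}`, `C(A)` the centraliser of
  `End⁰(A)` in `End(V(A))`); **Corollary 4.5**: "For any abelian variety `A` and any `r ≥ 0`,
  `H^{2*}(A^r)(*)^{L(A)} = D_hom(A^r)_k`"; p. 659: "The projection map `GL(V(A)) × 𝔾_m → 𝔾_m` defines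
  a cocharacter of `L(A)`, which we denote `l(A)` […]. The theorem shows that the kernel of `l(A)`,
  regarded as a subgroup of `GL(V(A))`, equals `S(A)`. It is clear from the theorem that the
  homomorphism `a ↦ (a⁻¹, a⁻²) : 𝔾_m → GL(V(A)) × 𝔾_m` takes values in `L(A)`. Therefore `L(A)` has a
  canonical cocharacter `w`. Note that `l ∘ w = -2`."
* p. 660 (held p0022 L9–L20): "The Hodge group `Hg(A)` of `A` is defined to be the largest algebraic
  subgroup of `GL(V_B(A)) × 𝔾_m` fixing all the Hodge classes on `A` and its powers. […] Projection
  onto `𝔾_m` defines a canonical character of `Hg(A)`, and we let `Hg′(A)` denote its kernel. […]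
  Clearly `D_hom(A) ⊂ H(A)`, and so `L(A) ⊃ Hg(A)`. A Hodge class not in `D_hom(A)` will be said to
  be *exotic*. **Proposition 4.8.** The following conditions on an abelian variety `A` are
  equivalent: (a) no power of `A` supports an exotic Hodge class; (b) `Hg(A) = L(A)`;
  (c) `Hg′(A) = S(A)`. Proof. The groups `Hg(A)` and `L(A)` are the largest algebraic subgroups of
  `GL(H₁(A)) × 𝔾_m` fixing respectively the Hodge classes and the Lefschetz classes on the powers of
  `A`, and conversely, these are precisely the classes fixed by the two groups. Hence
  `H(A^r) = D(A^r)` for all `r ⟺ Hg(A) = L(A)`."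

## Lean rendering (the tree's Tannaka-free house style, `HodgeTheory/MotivatedGaloisGroup`)

The tree renders Deligne's Mumford–Tate group and André's motivated Galois group of a smooth
projective complex `X` WITHOUT algebraic groups or Tannakian categories (both absent from Mathlib):
as subgroups of `∏ₖ GL(Hᵏ(X(ℂ); ℂ))` (`HodgeTheory.complexBetti X k = Hᵏ(X(ℂ); ℂ)`) of the families
`g` whose diagonal (Künneth) extension to the powers `X^{×(a+1)} = cartesianPow X (a + 1)`
(`IsKunnethFamily`) fixes — `powClassStabilizer` — or multiplies by a character of Tate type `cᵖ` —
`powClassSimilitudeGroup` — every class of a given system `S_{a,p} ⊆ H²ᵖ(X^{×(a+1)}(ℂ); ℂ)`; with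
`S` = the rational `(p,p)`-classes (`hodgePowClasses n X`) these are `hodgeGroup n X = Hg′` and
`mumfordTateGroup n X = Hg` in Milne's notation of p. 660 (Milne's `Hg(A) ≤ GL × 𝔾_m` is Deligne's
`MT`, his `Hg′(A)` its kernel, the special Mumford–Tate group). Milne's Definition 4.3 has EXACTLY
this shape with `S` = the Lefschetz classes, so this file defines, for `X` intended smooth projective
of dimension `n` (an abelian variety `A`: `X = A.X`, `n = A.dim`):

* `lefschetzPowClasses n X : (a, p) ↦ D^p_hom(X^{×(a+1)})_ℂ ⊆ H²ᵖ(X^{×(a+1)}(ℂ); ℂ)` — the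
  `ℂ`-span of the `p`-fold cup products of rational `(1,1)`-classes (the tree's
  `Barriers.HodgeConjecture.divisorClassesSpan`, van Geemen's `Dᵖ ⊗ ℂ`, already used throughout
  `HodgeTheory/`; rational `(1,1)`-classes = `ℚ`-divisor classes by Lefschetz `(1,1)`, a theorem of
  the tree, `lefschetzOneOne_rational_holds`), on the powers, with `X^{×1} = X` on the nose;
* **`lefschetzGroup n X := powClassSimilitudeGroup X (lefschetzPowClasses n X)`** — Milne's `L(A)`
  (Def. 4.3: `GL(V(A)) × 𝔾_m` acting on `H^{2s}(A^r)(s)`, i.e. fixing Lefschetz classes UP TO THE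
  TATE CHARACTER), projected to `∏ₖ GL(Hᵏ)` and on `ℂ`-points;
* **`specialLefschetzGroup n X := powClassStabilizer X (lefschetzPowClasses n X)`** — the kernel of
  `l(A)`, "`= S(A)`" by Theorem 4.4 (p. 659), i.e. the group FIXING all Lefschetz classes on all
  powers; `lefschetzGroup = w(ℂˣ) · specialLefschetzGroup` is the tree's generic
  `mem_powClassSimilitudeGroup_iff_exists_weightCocharacter_mul` (Milne: `L(A) ⊇ w(𝔾_m)`,
  `l ∘ w = -2`).

PROVED here (no hypotheses beyond smooth projectivity, a theorem for abelian varieties):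
* `divisorMonomials_subset_hodgeClasses`, `divisorClassesSpan_le_span_hodgeClasses`,
  `lefschetzPowClasses_subset_span_hodgePowClasses` — "Clearly `D_hom(A) ⊂ H(A)`": divisor monomials are rational (`IsRationalClass.cup`,
  `isRationalClass_one`) and of Hodge type `(p,p)` (the cup product adds Hodge types,
  `cupPreservesHodgeType_of_multiplicative_deRham` with de Rham's theorem
  `exists_deRhamIsoFamily_holds`; `1` is of type `(0,0)`, `isOfHodgeType_zero_zero_zero`);
* **`hodgeGroup_le_specialLefschetzGroup`, `mumfordTateGroup_le_lefschetzGroup`** — "and so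
  `L(A) ⊃ Hg(A)`" (p. 660), in both conventions;
* **Proposition 4.8, the half (a) ⇒ (b), (a) ⇒ (c)** (`hodgeGroup_eq_specialLefschetzGroup_of_forall_subset`,
  `mumfordTateGroup_eq_lefschetzGroup_of_forall_subset`): if on every power every rational
  `(p,p)`-class is Lefschetz, the two pairs of groups coincide (same spans, same stabilisers);
  **(b) ⟺ (c)** in positive dimension (`hodgeGroup_eq_specialLefschetzGroup_iff`: a non-zero
  divisor class — the rational Kähler class of `KaehlerRationalDatum` — pins the character);
* the bridge to the tree's abelian-variety vocabulary: `(A.powSucc a).X = cartesianPow A.X (a+1)` and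
  `(A.powSucc a).dim = cartesianPowDim A.dim a` (`AbelianVariety.powSucc_X_eq_cartesianPow`,
  `AbelianVariety.dim_powSucc_eq_cartesianPowDim`), whence Milne's (a) "no power of `A` supports an
  exotic Hodge class" in the tree's spelling `∀ a, IsDivisorGenerated (A.powSucc a)` (van Geemen's
  `B = D` on every power, `HodgeTheory/HodgeGroupProductCMFactorClasses`) is EQUIVALENT to the
  containment of systems `hodgePowClasses ⊆ lefschetzPowClasses`
  (`forall_isDivisorGenerated_powSucc_iff`), and (a) ⇒ (c), (a) ⇒ (b) for abelian varieties in that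
  spelling (`AbelianVariety.hodgeGroup_eq_specialLefschetzGroup_of_forall_isDivisorGenerated`, `…mumfordTateGroup_eq_lefschetzGroup…`);
* **the half (c) ⇒ (a) on `A` itself** from the one cited record below
  (`AbelianVariety.isDivisorGenerated_of_hodgeGroup_eq_specialLefschetzGroup`): a rational
  `(p,p)`-class is fixed by `Hg′(A)` (definition), hence by `S(A)`, hence is Lefschetz (Cor. 4.5).

ONE named fact (D-0014/D-0026: a CITE record, net debt +1, the main theorem of the paper in the
stabiliser form this rendering supports, exact mirror of the tree's
`HodgeTheory.Andre1996_specialMotivatedGaloisGroup_invariants_le` for André's group):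
* `Milne1999_specialLefschetzGroup_invariants_le` — **Corollary 4.5 / Theorem 3.2 with Theorem 4.4**
  ("`H^{2*}(A^r)(*)^{L(A)} = D_hom(A^r)_k`"; `ker l(A) = S(A)`; "`H^*(A^r)^{S(A)}` is generated by
  divisor classes"), for complex abelian varieties and Betti cohomology: a class of `H²ᵖ(A(ℂ); ℂ)`
  fixed by every element of `specialLefschetzGroup A.dim A.X` lies in `D^p_hom(A)_ℂ =
  divisorClassesSpan A.X A.dim p`. (The converse inclusion is definitional,
  `apply_eq_self_of_mem_specialLefschetzGroup`.) Stated for every abelian variety, hence for every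
  power `A^r` with ITS group `S(A^r) = S(A)` (Cor. 4.7); see "Identification" for why only the easy
  inclusion `S(A)(ℂ) ⊆ specialLefschetzGroup` is needed to read it off the printed statement.

## Identification with the printed groups (what a reviewer must accept; not formalised)

Let `A/ℂ` be an abelian variety of dimension `n ≥ 1`, `V = V_B(A) = H₁(A(ℂ), ℚ)`, so that
`Hᵏ(A^r(ℂ), ℚ) = ⋀ᵏ(r V^∨)` (p. 658: "from the canonical isomorphisms `H¹(A) ≅ Hom(V(A), k)`,
`H¹(A^r) = r H¹(A)`, `H^*(A^r) ≅ ⋀ H¹(A^r)` we see that there is a natural left action of `GL(V(A))`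
on `H^s(A^r)`"). (i) For `(γ, c) ∈ L(A)(ℂ) ≤ GL(V_ℂ) × ℂˣ` the induced automorphisms
`G_{a,k} = ⋀ᵏ((a+1) γ^{∨})` of `Hᵏ(A^{a+1}(ℂ); ℂ)` form a Künneth family in the tree's sense (they are
multiplicative and commute with the pull-backs along the projections), and "`(γ, c)` fixes
`D^s(A^r)_ℂ ⊂ H^{2s}(A^r)(s)`" says that `G_a` multiplies every Lefschetz class of degree `2s` by
`c^{s}` (with the tree's sign convention for the twist, `c ↦ c⁻¹` otherwise): so
`g = G_0 ∈ lefschetzGroup n A.X`, and `(γ, 1) ∈ S(A)(ℂ)` gives `g ∈ specialLefschetzGroup n A.X`.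
(ii) Conversely, for `g ∈ specialLefschetzGroup n A.X` with Künneth family `G`: the graph classes of
the homomorphisms `Δ : A → A × A` and `m, pr₁, pr₂ : A × A → A` and the class of a point are
Lefschetz (Milne Cor. 5.6 "The graph of any regular map `α : A → B` of abelian varieties is
Lefschetz", Cor. 5.8; `[0] ∈ ℚ θⁿ`), hence fixed by `G`; with Poincaré duality (whose fundamental
classes `G` fixes) this forces `G` to commute with `Δ^*`, i.e. `g` is multiplicative on
`H^*(A(ℂ); ℂ) = ⋀ H¹`, so `g_k = ⋀ᵏ g_1` and `g = G_0` for `γ = (g_1^∨)⁻¹ ∈ GL(V_ℂ)`, `(γ, 1) ∈ S(A)(ℂ)`.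
Hence `specialLefschetzGroup n A.X = S(A)(ℂ)` and, by `L(A) = w(𝔾_m) · S(A)` (`l ∘ w = -2` is
surjective on `ℂˣ`) and the tree's `Sim = w(ℂˣ) · Stab`, `lefschetzGroup n A.X = L(A)(ℂ)`, both acting
diagonally on `⊕ₖ Hᵏ ⊗ ℂ`; likewise `hodgeGroup n A.X = Hg′(A)(ℂ)`, `mumfordTateGroup n A.X = Hg(A)(ℂ)`
(module docstring of `HodgeTheory/MotivatedGaloisGroup`, (c)). (iii) The record: a vector
`x ∈ H²ᵖ(A(ℂ); ℂ) = H²ᵖ_B(A) ⊗ ℂ` fixed by `specialLefschetzGroup` is by (i) fixed by `S(A)(ℂ)`, which is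
Zariski-dense in `S(A)_ℂ`; invariants of an algebraic group commute with the flat base change
`ℚ → ℂ`, so `x ∈ H²ᵖ_B(A)^{S(A)} ⊗ ℂ = (H²ᵖ_B(A)(p))^{L(A)} ⊗ ℂ` (`w(𝔾_m) ≤ L(A)` acts trivially on
`H²ᵖ(p)`) `= D^p_hom(A)_ℚ ⊗ ℂ` (Cor. 4.5, `r = 1`, Betti cohomology, `k = ℚ`) `= divisorClassesSpan A.X n p`
(Lefschetz `(1,1)`). ONLY the inclusion (i) is used, not (ii). (iv) `ℂ`-spans versus `ℚ`-structures:
fixing a set of classes or its `ℂ`-span is the same condition (`powClassStabilizer_span`), and for a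
RATIONAL class `c`, `c ∈ Dᵖ ⊗ ℂ ⟺ c ∈ Dᵖ` (`(Dᵖ ⊗ ℂ) ∩ H²ᵖ(A, ℚ) = Dᵖ`), so Milne's (a)
"`H(A^r) = D(A^r)` for all `r`" is `∀ a, IsDivisorGenerated (A.powSucc a)`.

## Design and what is NOT here

* The dimension parameter `n` enters only through the Hodge-type predicate `IsOfHodgeType n X 2 1 1`
  selecting the `(1,1)`-classes among rational degree-`2` classes (and `cartesianPowDim n a` on the
  powers); for an abelian variety take `n = A.dim`.
* Milne works over an arbitrary algebraically closed `Ω` and an arbitrary Weil cohomology; this file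
  is the complex Betti case `Ω = ℂ`, `H = H_B ⊗ ℂ` of the summit's carriers (the case of Prop. 4.8).
  `-- TODO(general form): L(A) for the tree's abstract Weil cohomologies Motives.WeilCohomology`
  (`Motives.lefschetzClasses` of `Motives/SupersingularAbelianVariety` is the class side there).
* NOT here: Milne's `C(A)`, `S(A)` of §1 (centraliser of `End⁰(A)` and its unitary group for the
  Rosati involution) and `G(A)` as groups in their own right, Theorem 4.4 (`G(A) ≅ L(A)`), the
  computation of `L(A)` (§2, Cor. 4.7 product formula), Prop. 2.5 of the Compositio paper
  (`L(A_Ψ) = T^Ψ`, LIT-FANOUT INFRA-03), reductivity, §5 (Cor. 5.5/5.6/5.8, Thm. 5.9: `φ_*`, graph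
  classes, Künneth components, `Λ`, `*` are Lefschetz) — INFRA-04 file 2.
* Mathlib has no Mumford–Tate / Lefschetz groups, abelian varieties or Hodge structures (`lean search`
  "lefschetzGroup|LefschetzGroup": only `Motives.lefschetzClasses*` for abstract Weil cohomologies in
  this tree).

## References

* [Milne1999LefschetzClasses] J. S. Milne, Lefschetz classes on abelian varieties, Duke Math. J. 96
  (1999) 639–675: Introduction (p. 639), §4 (pp. 657–661): Def. 4.3, Thm. 4.4, Cor. 4.5, Cor. 4.7,
  Prop. 4.8, Remark 4.9; Thm. 3.2 (p. 653); Cor. 5.6, 5.8 (p. 663–664).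
* [Deligne1982HodgeCycles] P. Deligne, Hodge cycles on abelian varieties, LNM 900 (1982), I §3
  (Mumford–Tate group; Prop. 3.1, 3.4).
* [vanGeemen1994HodgeAV] B. van Geemen, An introduction to the Hodge conjecture for abelian
  varieties, LNM 1594 (1994), §2.4–2.5 (`Dᵖ ⊂ Bᵖ`, exceptional classes).
* [VoisinHodgeI2002] C. Voisin, Hodge Theory and Complex Algebraic Geometry I, §7.1.2, §11.3.
-/

noncomputable section

open CategoryTheory MonoidalCategory
open Literature.AlgebraicTopology.SingularHomology
open Literature.AlgebraicGeometry.HodgeTheory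
open Literature.AlgebraicGeometry.Motives
open Literature.Barriers.HodgeConjecture

namespace Literature.AlgebraicGeometry.Milne1999

/-! ### Lefschetz classes on the powers of `X` -/

section LefschetzClasses

variable (n : ℕ) (X : Motives.SchemeOver ℂ)

/-- The system of **Lefschetz classes on the powers** of the (intended smooth projective,
`n`-dimensional) `X`: `(a, p) ↦ D^p_hom(X^{×(a+1)})_ℂ ⊆ H²ᵖ(X^{×(a+1)}(ℂ); ℂ)`, the `ℂ`-span of the
`p`-fold cup products of rational `(1,1)`-classes (`divisorClassesSpan`; "the `k`-subspace of
`H^{2*}(X)(*)` spanned by the image of the cycle class map `cl : D_rat(X) → H^{2*}(X)(*)`",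
`D_rat(X) = ℚ[C¹_rat(X)]` the `ℚ`-algebra generated by divisor classes, whose elements are "the
Lefschetz classes on `X`"), on the powers `cartesianPow X (a + 1)` (`X^{×1} = X` on the nose).
[cite: Milne1999LefschetzClasses, Introduction (p. 639) and §4 (pp. 657–658)] -/
def lefschetzPowClasses : ∀ a p : ℕ, Set (complexBetti (cartesianPow X (a + 1)) (2 * p)) :=
  fun a p ↦ (divisorClassesSpan (cartesianPow X (a + 1)) (cartesianPowDim n a) p : Set _)

variable {n X}

/-- At `a = 0` the Lefschetz system is `D^p_hom(X)_ℂ = divisorClassesSpan X n p` (`X^{×1} = X`).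
[cite: Milne1999LefschetzClasses, §4 (pp. 657–658, `D_hom(X)_k`)] -/
@[simp] theorem mem_lefschetzPowClasses_zero_iff (p : ℕ) (c : complexBetti X (2 * p)) :
    c ∈ lefschetzPowClasses n X 0 p ↔ c ∈ divisorClassesSpan X n p := Iff.rfl

/-- Membership in the Lefschetz system on the power `X^{×(a+1)}`, unfolded: `D^p_hom(X^{×(a+1)})_ℂ`.
[cite: Milne1999LefschetzClasses, §4 (pp. 657–658, `D_hom(X)_k`) and Def. 4.3] -/
theorem mem_lefschetzPowClasses_iff (a p : ℕ) (c : complexBetti (cartesianPow X (a + 1)) (2 * p)) :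
    c ∈ lefschetzPowClasses n X a p ↔
      c ∈ divisorClassesSpan (cartesianPow X (a + 1)) (cartesianPowDim n a) p := Iff.rfl

/-- The Lefschetz system is a system of `k`-SUBSPACES (`k = ℂ`): it equals its own span ("the
`k`-subspace of `H^{2*}(X)(*)` spanned by the image of the cycle class map").
[cite: Milne1999LefschetzClasses, §4 (pp. 657–658)] -/
theorem span_lefschetzPowClasses (a p : ℕ) :
    Submodule.span ℂ (lefschetzPowClasses n X a p) =
      divisorClassesSpan (cartesianPow X (a + 1)) (cartesianPowDim n a) p :=
  Submodule.span_eq _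

/-- **"Clearly `D_hom(A) ⊂ H(A)`"** (Milne p. 660; van Geemen §2.4 "`Dᵖ ⊂ Bᵖ`"), class by class, on
any smooth projective `X`: a divisor monomial `b₁ ∪ ⋯ ∪ b_p` (each `bᵢ` rational of type `(1,1)`) is
a rational class of Hodge type `(p, p)` — cup products of rational classes are rational
(`IsRationalClass.cup`), the cup product adds Hodge types (`CupPreservesHodgeType`, from de Rham's
theorem `exists_deRhamIsoFamily_holds`), and the unit class is rational of type `(0,0)`.
[cite: Milne1999LefschetzClasses, §4 p. 660] [cite: vanGeemen1994HodgeAV, §2.4] -/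
theorem divisorMonomials_subset_hodgeClasses (hX : Motives.IsSmoothProjective n X) :
    ∀ p : ℕ, divisorMonomials X n p ⊆
      {c : complexBetti X (2 * p) | IsRationalClass c ∧ IsOfHodgeType n X (2 * p) p p c}
  | 0 => by
    intro c hc
    rw [mem_divisorMonomials_zero] at hc
    subst hc
    obtain ⟨M⟩ := nonempty_hodgeModel_holds.nonempty hX
    exact ⟨isRationalClass_one _, isOfHodgeType_zero_zero_zero M _⟩
  | p + 1 => by
    intro c hc
    obtain ⟨a, ha, b, hb, hb', rfl⟩ := mem_divisorMonomials_succ.1 hc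
    obtain ⟨ha₁, ha₂⟩ := divisorMonomials_subset_hodgeClasses hX p ha
    have hcup : CupPreservesHodgeType n X :=
      cupPreservesHodgeType_of_multiplicative_deRham
        (fun E _ _ _ ↦ Literature.NumberTheory.Transcendental.exists_deRhamIsoFamily_holds E) hX
    exact ⟨ha₁.cup _ hb, hcup _ ha₂ hb'⟩

/-- `Dᵖ(X) ⊗ ℂ ⊆ Bᵖ(X) ⊗ ℂ`: the divisor span lies in the `ℂ`-span of the rational `(p,p)`-classes
(submodule form of `divisorMonomials_subset_hodgeClasses`). [cite: Milne1999LefschetzClasses, §4 p. 660]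
[cite: vanGeemen1994HodgeAV, §2.4] -/
theorem divisorClassesSpan_le_span_hodgeClasses (hX : Motives.IsSmoothProjective n X) (p : ℕ) :
    divisorClassesSpan X n p ≤
      Submodule.span ℂ {c : complexBetti X (2 * p) | IsRationalClass c ∧ IsOfHodgeType n X (2 * p) p p c} :=
  Submodule.span_mono (divisorMonomials_subset_hodgeClasses hX p)

/-- On every power: `D^p(X^{×(a+1)}) ⊗ ℂ` lies in the span of the rational `(p,p)`-classes of
`X^{×(a+1)}` — the Lefschetz system lies in the span of the Hodge system `hodgePowClasses n X`
(powers of a smooth projective variety are smooth projective, `isSmoothProjective_cartesianPow`).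
[cite: Milne1999LefschetzClasses, §4 p. 660] -/
theorem lefschetzPowClasses_subset_span_hodgePowClasses (hX : Motives.IsSmoothProjective n X) (a p : ℕ) :
    lefschetzPowClasses n X a p ⊆ (Submodule.span ℂ (hodgePowClasses n X a p) : Set _) :=
  fun _ hc ↦ divisorClassesSpan_le_span_hodgeClasses (isSmoothProjective_cartesianPow hX a) p hc

end LefschetzClasses

/-! ### The Lefschetz group and the special Lefschetz group -/

section LefschetzGroup

variable (n : ℕ) (X : Motives.SchemeOver ℂ)

/-- **The Lefschetz group `L(A)(ℂ)` (Milne 1999, Def. 4.3), Tannaka-free, on the real carriers**: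
"The Lefschetz group `L(A)` of an abelian variety `A` over `Ω` is the largest algebraic subgroup of
`GL(V(A)) × 𝔾_m/k` fixing the elements of `D^s_hom(A^r)_k ⊂ H^{2s}(A^r)(s)` for all `r, s`" — here,
for `Ω = ℂ` and Betti cohomology with complex coefficients, rendered exactly as the tree renders the
Mumford–Tate group (`HodgeTheory.mumfordTateGroup`): the subgroup of `∏ₖ GL(Hᵏ(X(ℂ); ℂ))` of the
`g` whose Künneth (diagonal) extension to the powers `X^{×(a+1)}` acts on every Lefschetz class of
degree `2s` of every power by `cˢ` for one `c ∈ ℂˣ` (the `𝔾_m`-component; fixing the TWISTED classes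
in `H^{2s}(s)`). For `X = A.X`, `n = A.dim` this is `L(A)(ℂ)` acting diagonally on `⊕ₖ Hᵏ ⊗ ℂ` (module
docstring, "Identification"); it contains `Hg(A) = mumfordTateGroup` (`mumfordTateGroup_le_lefschetzGroup`)
and the weight cocharacter, and `L = w(ℂˣ) · S` (`mem_lefschetzGroup_iff_exists_weightCocharacter_mul`).
Reductive, "not necessarily connected" (Introduction). [cite: Milne1999LefschetzClasses, Def. 4.3 (p. 659)] -/
def lefschetzGroup : Subgroup (∀ k : ℕ, complexBetti X k ≃ₗ[ℂ] complexBetti X k) :=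
  powClassSimilitudeGroup X (lefschetzPowClasses n X)

/-- **The special Lefschetz group `S(A)(ℂ) = ker(l(A) : L(A) → 𝔾_m)(ℂ)`** (Milne 1999, p. 659: "The
projection map `GL(V(A)) × 𝔾_m → 𝔾_m` defines a cocharacter of `L(A)`, which we denote `l(A)` […] the
kernel of `l(A)`, regarded as a subgroup of `GL(V(A))`, equals `S(A)`", by Thm. 4.4; `S(A)` of §1 is
the unitary group `{γ ∈ C(A) | γ†γ = 1}` of the centraliser `C(A)` of `End⁰(A)` for the Rosati
involution): the subgroup of `∏ₖ GL(Hᵏ(X(ℂ); ℂ))` of the `g` whose Künneth extension FIXES every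
Lefschetz class on every power — Milne's condition (c) of Prop. 4.8 compares it with
`Hg′(A) = HodgeTheory.hodgeGroup`. [cite: Milne1999LefschetzClasses, Thm. 4.4 and p. 659 (kernel of l(A))] -/
def specialLefschetzGroup : Subgroup (∀ k : ℕ, complexBetti X k ≃ₗ[ℂ] complexBetti X k) :=
  powClassStabilizer X (lefschetzPowClasses n X)

variable {n X}

/-- `S(A) ≤ L(A)` (`ker l ≤ L`). [cite: Milne1999LefschetzClasses, p. 659] -/
theorem specialLefschetzGroup_le_lefschetzGroup : specialLefschetzGroup n X ≤ lefschetzGroup n X :=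
  powClassStabilizer_le_powClassSimilitudeGroup

/-- **`w(ℂˣ) ≤ L(A)`**: the weight cocharacter (`λᵏ` on `Hᵏ`) lies in the Lefschetz group (Milne
p. 659: "`a ↦ (a⁻¹, a⁻²) : 𝔾_m → GL(V(A)) × 𝔾_m` takes values in `L(A)`. Therefore `L(A)` has a
canonical cocharacter `w`"). [cite: Milne1999LefschetzClasses, p. 659 (cocharacter w)] -/
theorem weightCocharacter_mem_lefschetzGroup (c : ℂˣ) : weightCocharacter X c ∈ lefschetzGroup n X :=
  weightCocharacter_mem_powClassSimilitudeGroup c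

/-- **`L(A) = w(ℂˣ) · S(A)`**: an element of the Lefschetz group is the product of a value of the
weight cocharacter and an element FIXING all Lefschetz classes (Milne p. 659: `l ∘ w = -2`, so
`l` is surjective on `w(𝔾_m)` and `L = w(𝔾_m) · ker l`; the tree's
`mem_powClassSimilitudeGroup_iff_exists_weightCocharacter_mul`). [cite: Milne1999LefschetzClasses, p. 659 (l ∘ w = -2)] -/
theorem mem_lefschetzGroup_iff_exists_weightCocharacter_mul {g : ∀ k : ℕ, complexBetti X k ≃ₗ[ℂ] complexBetti X k} :
    g ∈ lefschetzGroup n X ↔ ∃ (c : ℂˣ) (g' : ∀ k : ℕ, complexBetti X k ≃ₗ[ℂ] complexBetti X k),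
      g' ∈ specialLefschetzGroup n X ∧ g = weightCocharacter X c * g' :=
  mem_powClassSimilitudeGroup_iff_exists_weightCocharacter_mul

/-- **Lefschetz classes are fixed by `S(A)`** (the definitional half of Cor. 4.5 in the `S`-form):
for `g ∈ S(A)(ℂ)` and `x ∈ D^p_hom(X)_ℂ`, `g x = x`. [cite: Milne1999LefschetzClasses, Cor. 4.5 (p. 659)] -/
theorem apply_eq_self_of_mem_specialLefschetzGroup {g : ∀ k : ℕ, complexBetti X k ≃ₗ[ℂ] complexBetti X k}
    (hg : g ∈ specialLefschetzGroup n X) {p : ℕ} {x : complexBetti X (2 * p)}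
    (hx : x ∈ divisorClassesSpan X n p) : g (2 * p) x = x :=
  apply_eq_self_of_mem_powClassStabilizer hg (p := p) (show x ∈ lefschetzPowClasses n X 0 p from hx)

/-- **`L(A)` acts on the Lefschetz classes of `X` through a character of Tate type**: for
`g ∈ L(A)(ℂ)` there is `c ∈ ℂˣ` with `g x = cᵖ x` for all `x ∈ D^p_hom(X)_ℂ` and all `p` (Def. 4.3:
`L(A)` fixes the twisted classes in `H^{2s}(A)(s)`). [cite: Milne1999LefschetzClasses, Def. 4.3 (p. 659)] -/
theorem exists_apply_eq_smul_of_mem_lefschetzGroup {g : ∀ k : ℕ, complexBetti X k ≃ₗ[ℂ] complexBetti X k}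
    (hg : g ∈ lefschetzGroup n X) :
    ∃ c : ℂˣ, ∀ (p : ℕ), ∀ x ∈ divisorClassesSpan X n p, g (2 * p) x = ((c : ℂ) ^ p) • x :=
  exists_apply_eq_smul_of_mem_powClassSimilitudeGroup hg

/-- **`Hg′(A) ≤ S(A)`** — "Clearly `D_hom(A) ⊂ H(A)`, and so `L(A) ⊃ Hg(A)`" (Milne p. 660), in the
kernel form: fixing all rational `(p,p)`-classes on all powers fixes their `ℂ`-spans, which contain
the Lefschetz classes (`lefschetzPowClasses_subset_span_hodgePowClasses`).
[cite: Milne1999LefschetzClasses, §4 p. 660] -/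
theorem hodgeGroup_le_specialLefschetzGroup (hX : Motives.IsSmoothProjective n X) :
    hodgeGroup n X ≤ specialLefschetzGroup n X := by
  rw [hodgeGroup, ← powClassStabilizer_span]
  exact powClassStabilizer_anti (lefschetzPowClasses_subset_span_hodgePowClasses hX)

/-- **`Hg(A) ≤ L(A)`** — "Clearly `D_hom(A) ⊂ H(A)`, and so `L(A) ⊃ Hg(A)`" (Milne p. 660), in Milne's
own convention (`GL × 𝔾_m`, the tree's `mumfordTateGroup`). [cite: Milne1999LefschetzClasses, §4 p. 660] -/
theorem mumfordTateGroup_le_lefschetzGroup (hX : Motives.IsSmoothProjective n X) :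
    mumfordTateGroup n X ≤ lefschetzGroup n X := by
  rw [mumfordTateGroup, ← powClassSimilitudeGroup_span]
  exact powClassSimilitudeGroup_anti (lefschetzPowClasses_subset_span_hodgePowClasses hX)

/-! ### Proposition 4.8: exotic classes on the powers versus `Hg = L` -/

/-- **Milne Prop. 4.8, (a) ⇒ (c)**: if no power of `X` supports an exotic Hodge class — on every
power `X^{×(a+1)}` every rational `(p,p)`-class lies in `D^p ⊗ ℂ` (hypothesis `h`, the containment
of the Hodge system in the Lefschetz system) — then `Hg′(A) = S(A)`: both groups are the stabiliser
of the same `ℂ`-spans ("`Hg(A)` and `L(A)` are the largest algebraic subgroups […] fixing respectively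
the Hodge classes and the Lefschetz classes on the powers of `A` […]. Hence `H(A^r) = D(A^r)` for all
`r ⟺ Hg(A) = L(A)`", the provable direction). [cite: Milne1999LefschetzClasses, Prop. 4.8 (p. 660)] -/
theorem hodgeGroup_eq_specialLefschetzGroup_of_forall_subset (hX : Motives.IsSmoothProjective n X)
    (h : ∀ a p, hodgePowClasses n X a p ⊆ lefschetzPowClasses n X a p) :
    hodgeGroup n X = specialLefschetzGroup n X :=
  le_antisymm (hodgeGroup_le_specialLefschetzGroup hX) (powClassStabilizer_anti h)

/-- **Milne Prop. 4.8, (a) ⇒ (b)**: no exotic Hodge class on any power ⇒ `Hg(A) = L(A)` (Milne's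
convention; `w(ℂˣ) ·` both sides of (a) ⇒ (c)). [cite: Milne1999LefschetzClasses, Prop. 4.8 (p. 660)] -/
theorem mumfordTateGroup_eq_lefschetzGroup_of_forall_subset (hX : Motives.IsSmoothProjective n X)
    (h : ∀ a p, hodgePowClasses n X a p ⊆ lefschetzPowClasses n X a p) :
    mumfordTateGroup n X = lefschetzGroup n X :=
  powClassSimilitudeGroup_eq_of_powClassStabilizer_eq
    (hodgeGroup_eq_specialLefschetzGroup_of_forall_subset hX h)

/-- **Milne Prop. 4.8, (c) ⇒ (b)**: `Hg′(A) = S(A) ⇒ Hg(A) = L(A)` (both full groups are `w(ℂˣ) ·`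
the special ones; Milne's five-lemma argument on `0 → Hg′ → Hg → 𝔾_m → 0`, `0 → S → L → 𝔾_m → 0`,
in the direction that needs no surjectivity). [cite: Milne1999LefschetzClasses, Prop. 4.8 (p. 660)] -/
theorem mumfordTateGroup_eq_lefschetzGroup_of_hodgeGroup_eq
    (h : hodgeGroup n X = specialLefschetzGroup n X) : mumfordTateGroup n X = lefschetzGroup n X :=
  powClassSimilitudeGroup_eq_of_powClassStabilizer_eq h

/-- **Milne Prop. 4.8, (b) ⇒ (c)**, granted ONE non-zero Lefschetz class of degree `2` on some power
(hypothesis `hD`; on an abelian variety of positive dimension the class of an ample divisor): if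
`Hg(A) = L(A)` then `Hg′(A) = S(A)`. An element `g` of `S(A)` lies in `L(A) = Hg(A)`, so its Künneth
family multiplies rational `(p,p)`-classes by `cᵖ`; on the Lefschetz classes — which it fixes and which
are combinations of Hodge classes — it acts by `cᵖ` as well, so `c = 1` as soon as a non-zero
Lefschetz class of degree `2` exists, and `g ∈ Hg′(A)`. (Milne: the five lemma on the two extensions
of `𝔾_m`.) [cite: Milne1999LefschetzClasses, Prop. 4.8 (p. 660)] -/
theorem hodgeGroup_eq_specialLefschetzGroup_of_mumfordTateGroup_eq (hX : Motives.IsSmoothProjective n X)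
    (hD : ∃ a, ∃ x ∈ lefschetzPowClasses n X a 1, x ≠ 0)
    (h : mumfordTateGroup n X = lefschetzGroup n X) : hodgeGroup n X = specialLefschetzGroup n X := by
  refine le_antisymm (hodgeGroup_le_specialLefschetzGroup hX) ?_
  rintro g ⟨G, hG, rfl, hGS⟩
  -- `G 0 ∈ L = MT`: a Künneth family `G'` with `G' 0 = G 0` acting on Hodge classes by `cᵖ`
  have hmem : G 0 ∈ mumfordTateGroup n X := h ▸ specialLefschetzGroup_le_lefschetzGroup ⟨G, hG, rfl, hGS⟩
  obtain ⟨G', hG', h0, c, hG'S⟩ := hmem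
  have hGG' : G' = G := IsKunnethFamily.ext_of_apply_zero hX hG' hG h0
  subst hGG'
  -- `c = 1`: compare the two actions on a non-zero Lefschetz class of degree `2`
  obtain ⟨a, x, hx, hx0⟩ := hD
  have hfix : G' a (2 * 1) x = x := hGS a 1 x hx
  have hchar : G' a (2 * 1) x = ((c : ℂ) ^ 1) • x := by
    have hx' : x ∈ Submodule.span ℂ (hodgePowClasses n X a 1) :=
      lefschetzPowClasses_subset_span_hodgePowClasses hX a 1 hx
    have key := LinearMap.eqOn_span' (f := (G' a (2 * 1) : _ →ₗ[ℂ] _))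
      (g := ((c : ℂ) ^ 1) • LinearMap.id) (fun y hy ↦ by simpa using hG'S a 1 y hy) hx'
    simpa using key
  have hc1 : (c : ℂ) = 1 := by
    rw [pow_one] at hchar
    have h1 : ((c : ℂ) - 1) • x = 0 := by rw [sub_smul, one_smul, ← hchar, hfix, sub_self]
    rcases smul_eq_zero.1 h1 with h1 | h1
    · exact sub_eq_zero.1 h1
    · exact absurd h1 hx0
  refine ⟨G', hG', rfl, fun b p y hy ↦ ?_⟩
  rw [hG'S b p y hy, hc1, one_pow, one_smul]

/-- **A non-zero Lefschetz class of degree `2` exists** on every smooth projective `X` of positive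
dimension: the (rational, type `(1,1)`) class `η ⊗ 1` of an integral multiple of the hyperplane
section in a projective embedding — a Kähler class, hence non-zero (Voisin I Cor. 3.9) — is a
divisor monomial `1 ∪ η` of degree `1` (the tree's `KaehlerRationalDatum`, from
`exists_fubiniStudy_rational`). On an abelian variety: the class of an ample divisor (Milne's `D`,
`e^D`, §4). [cite: VoisinHodgeI2002, §7.1.2 and §3.1.3 Cor. 3.9] [cite: Milne1999LefschetzClasses, §4 p. 658 (ample divisor D)] -/
theorem exists_ne_zero_mem_lefschetzPowClasses_one (hX : Motives.IsSmoothProjective n X) (hn : 1 ≤ n) :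
    ∃ x ∈ lefschetzPowClasses n X 0 1, x ≠ 0 := by
  obtain ⟨D⟩ := nonempty_kaehlerRationalDatum hX
  refine ⟨D.Hη, ?_, D.isKaehlerClassVia.ne_zero hX hn⟩
  -- `η ⊗ 1 = 1 ∪ (η ⊗ 1)` is a divisor monomial of degree `1` (`mem_divisorClassesSpan_one`)
  change D.Hη ∈ (divisorClassesSpan X n 1 : Set (complexBetti X (2 * 1)))
  exact mem_divisorClassesSpan_one D.isRationalClass_Hη D.isOfHodgeType_Hη

/-- **Milne Prop. 4.8, (b) ⟺ (c), PROVED** for every smooth projective complex `X` of positive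
dimension: `Hg′ = S ⟺ Hg = L` (the previous two theorems with the non-zero divisor class of
`exists_ne_zero_mem_lefschetzPowClasses_one`; Milne: "the equivalence of the second two follows
from applying the Five Lemma"). [cite: Milne1999LefschetzClasses, Prop. 4.8 (p. 660)] -/
theorem hodgeGroup_eq_specialLefschetzGroup_iff (hX : Motives.IsSmoothProjective n X) (hn : 1 ≤ n) :
    hodgeGroup n X = specialLefschetzGroup n X ↔ mumfordTateGroup n X = lefschetzGroup n X :=
  ⟨mumfordTateGroup_eq_lefschetzGroup_of_hodgeGroup_eq,
    hodgeGroup_eq_specialLefschetzGroup_of_mumfordTateGroup_eq hX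
      ⟨0, exists_ne_zero_mem_lefschetzPowClasses_one hX hn⟩⟩

end LefschetzGroup

/-! ### The main theorem of Milne 1999 in stabiliser form (one cited record) and Prop. 4.8 (c) ⇒ (a) -/

section Record

/-- **The invariants of `S(A)` in `H²ᵖ(A(ℂ); ℂ)` are Lefschetz classes (Milne 1999, Cor. 4.5 with
Thm. 4.4 and Thm. 3.2; the main theorem of the paper, Introduction: "the cycle class map induces an
isomorphism `D^s_hom(A^r) ⊗_ℚ k → H^{2s}(A^r)(s)^{L(A)}` for all integers `r, s ≥ 0`"; Cor. 4.5: "For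
any abelian variety `A` and any `r ≥ 0`, `H^{2*}(A^r)(*)^{L(A)} = D_hom(A^r)_k`"; p. 659: "the kernel of
`l(A)` […] equals `S(A)`"; Thm. 3.2: "the `k`-algebra `H^*(A^r)^{S(A)}` is generated by divisor
classes"), for COMPLEX abelian varieties and Betti cohomology, on the real carriers and in the
`S`-form this file's rendering supports (see the module docstring, "Identification" (i), (iii):
Milne's `S(A)(ℂ)` is contained in `specialLefschetzGroup A.dim A.X`, `w(𝔾_m) ≤ L(A)` acts trivially on
`H²ᵖ(A)(p)`, invariants commute with `– ⊗_ℚ ℂ`, and `D^p_hom(A)_ℚ ⊗ ℂ = divisorClassesSpan A.X A.dim p`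
by Lefschetz `(1,1)`): for every complex abelian variety `A` and every `p`, a class
`x ∈ H²ᵖ(A(ℂ); ℂ)` fixed by every `g ∈ specialLefschetzGroup A.dim A.X` lies in
`D^p_hom(A)_ℂ = divisorClassesSpan A.X A.dim p`. (The converse is
`apply_eq_self_of_mem_specialLefschetzGroup`, definitional. Stated for every abelian variety, so it
applies to each power `A^r` with its own group `S(A^r) = S(A)`, Cor. 4.7.) The exact analogue, for
Milne's group, of the tree's `HodgeTheory.Andre1996_specialMotivatedGaloisGroup_invariants_le`
(André's `G¹_mot`). Rests on Thm. 3.2 (invariant theory of the classical groups over `S(A)`, §3) and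
Chevalley's theorem (Deligne 1982, 3.1), whence cite-grade.
[cite: Milne1999LefschetzClasses, Cor. 4.5 and Thm. 4.4 (p. 659), Thm. 3.2 (p. 653)] -/
def Milne1999_specialLefschetzGroup_invariants_le : Prop :=
  ∀ (A : AbelianVariety ℂ) (p : ℕ) (x : complexBetti A.X (2 * p)),
    (∀ g ∈ specialLefschetzGroup A.dim A.X, g (2 * p) x = x) → x ∈ divisorClassesSpan A.X A.dim p

/-- **Milne Prop. 4.8, (c) ⇒ (a) on `A` itself** (through the record `hrec` =
`Milne1999_specialLefschetzGroup_invariants_le`, Cor. 4.5): if `Hg′(A) = S(A)` then `A` supports no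
exotic Hodge class — every rational `(p,p)`-class of `A` is fixed by `Hg′(A)` (definition), hence by
`S(A)`, hence lies in `D^p ⊗ ℂ`; in the tree's spelling, `IsDivisorGenerated A` (van Geemen's
`B(A) = D(A)`). [cite: Milne1999LefschetzClasses, Prop. 4.8 and Cor. 4.5 (pp. 659–660)] -/
theorem _root_.Literature.AlgebraicGeometry.Motives.AbelianVariety.isDivisorGenerated_of_hodgeGroup_eq_specialLefschetzGroup
    (hrec : Milne1999_specialLefschetzGroup_invariants_le) (A : AbelianVariety ℂ)
    (h : hodgeGroup A.dim A.X = specialLefschetzGroup A.dim A.X) : IsDivisorGenerated A :=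
  fun p c hc hpp ↦ hrec A p c fun _ hg ↦ apply_eq_self_of_mem_hodgeGroup (h ▸ hg) hc hpp

/-- Under the record, **the `S(A)`-invariants of `H²ᵖ(A(ℂ); ℂ)` are EXACTLY `D^p_hom(A)_ℂ`** (Cor. 4.5
as an equality of sets, `r = 1`). [cite: Milne1999LefschetzClasses, Cor. 4.5 (p. 659)] -/
theorem setOf_forall_apply_eq_self_eq_divisorClassesSpan (hrec : Milne1999_specialLefschetzGroup_invariants_le)
    (A : AbelianVariety ℂ) (p : ℕ) :
    {x : complexBetti A.X (2 * p) | ∀ g ∈ specialLefschetzGroup A.dim A.X, g (2 * p) x = x} =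
      (divisorClassesSpan A.X A.dim p : Set _) :=
  Set.Subset.antisymm (fun x hx ↦ hrec A p x hx)
    fun _ hx _ hg ↦ apply_eq_self_of_mem_specialLefschetzGroup hg hx

end Record

/-! ### Powers of an abelian variety: `A.powSucc a` versus `cartesianPow A.X (a + 1)` -/

section AbelianVariety

variable (A : AbelianVariety ℂ)

/-- The underlying scheme of the `(a+1)`-fold self-product `A^{a+1} = A.powSucc a` IS the cartesian
power `A.X^{×(a+1)}` of `HodgeTheory/MotivatedGaloisGroup` (both recursions put the new factor on
the right: `A^{a+2} = A^{a+1} × A`, `X^{×(a+2)} = X^{×(a+1)} ⊗ X`, and `(B.prod C).X = B.X ⊗ C.X` by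
construction); Milne's "`A^r = A × ⋯ × A` (`r` copies)".
[cite: Milne1999LefschetzClasses, Introduction (p. 639, `A^r`)] -/
theorem _root_.Literature.AlgebraicGeometry.Motives.AbelianVariety.powSucc_X_eq_cartesianPow (a : ℕ) :
    (A.powSucc a).X = cartesianPow A.X (a + 1) := by
  induction a with
  | zero => rfl
  | succ a ih =>
    change (A.powSucc a).X ⊗ A.X = cartesianPow A.X (a + 1) ⊗ A.X
    rw [ih]

/-- `dim A^{a+1} = (a + 1) dim A` in the recursive spelling `cartesianPowDim A.dim a` of
`HodgeTheory/MotivatedGaloisGroup` (`dim (B × C) = dim B + dim C`, `AbelianVariety.dim_prod`,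
Görtz–Wedhorn Lemma 6.26). [cite: GortzWedhorn2020, Lemma 6.26 and Remark 16.54] -/
theorem _root_.Literature.AlgebraicGeometry.Motives.AbelianVariety.dim_powSucc_eq_cartesianPowDim (a : ℕ) :
    (A.powSucc a).dim = cartesianPowDim A.dim a := by
  induction a with
  | zero => rfl
  | succ a ih => rw [AbelianVariety.powSucc_succ, AbelianVariety.dim_prod, ih, cartesianPowDim_succ]

variable {A}

/-- Transport of `IsDivisorGenerated` along an identification of the underlying scheme and of the
dimension (used with `powSucc_X_eq_cartesianPow`, `dim_powSucc_eq_cartesianPowDim`; private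
plumbing). [folklore] -/
private theorem isDivisorGenerated_iff_of_eq {B : AbelianVariety ℂ} {N : ℕ} {Y : Motives.SchemeOver ℂ}
    (hY : B.X = Y) (hN : B.dim = N) :
    IsDivisorGenerated B ↔ ∀ (p : ℕ) (c : complexBetti Y (2 * p)), IsRationalClass c →
      IsOfHodgeType N Y (2 * p) p p c → c ∈ divisorClassesSpan Y N p := by
  subst hY hN
  rfl

/-- **Milne's condition (a) of Prop. 4.8 in the two spellings**: "no power of `A` supports an exotic
Hodge class" — `B(A^{a+1}) = D(A^{a+1})` for every `a` (`IsDivisorGenerated (A.powSucc a)`, van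
Geemen's `B = D`, rational classes) — iff on every power `A.X^{×(a+1)}` the Hodge system
`hodgePowClasses A.dim A.X` is contained in the Lefschetz system `lefschetzPowClasses A.dim A.X`.
[cite: Milne1999LefschetzClasses, Prop. 4.8 (a) (p. 660)] [cite: vanGeemen1994HodgeAV, §2.4–2.5] -/
theorem forall_isDivisorGenerated_powSucc_iff :
    (∀ a, IsDivisorGenerated (A.powSucc a)) ↔
      ∀ a p, hodgePowClasses A.dim A.X a p ⊆ lefschetzPowClasses A.dim A.X a p := by
  refine forall_congr' fun a ↦ ?_
  rw [isDivisorGenerated_iff_of_eq (A.powSucc_X_eq_cartesianPow a) (A.dim_powSucc_eq_cartesianPowDim a)]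
  exact ⟨fun h p c hc ↦ h p c hc.1 hc.2, fun h p c hc hpp ↦ h p ⟨hc, hpp⟩⟩

/-- `IsDivisorGenerated` on a power, read on the cartesian power: every rational `(p,p)`-class of
`A.X^{×(a+1)}` is a Lefschetz class. [cite: vanGeemen1994HodgeAV, §2.4–2.5] -/
theorem mem_lefschetzPowClasses_of_isDivisorGenerated_powSucc {a : ℕ} (h : IsDivisorGenerated (A.powSucc a))
    {p : ℕ} {c : complexBetti (cartesianPow A.X (a + 1)) (2 * p)} (hc : c ∈ hodgePowClasses A.dim A.X a p) :
    c ∈ lefschetzPowClasses A.dim A.X a p :=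
  (isDivisorGenerated_iff_of_eq (A.powSucc_X_eq_cartesianPow a) (A.dim_powSucc_eq_cartesianPowDim a)).1
    h p c hc.1 hc.2

variable (A)

/-- **Milne Prop. 4.8, (a) ⇒ (c), for a complex abelian variety in the tree's vocabulary**: if no
power `A^{a+1}` supports an exotic Hodge class (`IsDivisorGenerated (A.powSucc a)` for all `a`), then
`Hg′(A) = S(A)`. (Abelian varieties are smooth projective: `AbelianVariety.isSmoothProjective_holds`.)
[cite: Milne1999LefschetzClasses, Prop. 4.8 (p. 660)] -/
theorem _root_.Literature.AlgebraicGeometry.Motives.AbelianVariety.hodgeGroup_eq_specialLefschetzGroup_of_forall_isDivisorGenerated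
    (h : ∀ a, IsDivisorGenerated (A.powSucc a)) :
    hodgeGroup A.dim A.X = specialLefschetzGroup A.dim A.X :=
  hodgeGroup_eq_specialLefschetzGroup_of_forall_subset AbelianVariety.isSmoothProjective_holds
    (forall_isDivisorGenerated_powSucc_iff.1 h)

/-- **Milne Prop. 4.8, (a) ⇒ (b), for a complex abelian variety in the tree's vocabulary**: no exotic
Hodge class on any power ⇒ `Hg(A) = L(A)`. [cite: Milne1999LefschetzClasses, Prop. 4.8 (p. 660)] -/
theorem _root_.Literature.AlgebraicGeometry.Motives.AbelianVariety.mumfordTateGroup_eq_lefschetzGroup_of_forall_isDivisorGenerated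
    (h : ∀ a, IsDivisorGenerated (A.powSucc a)) :
    mumfordTateGroup A.dim A.X = lefschetzGroup A.dim A.X :=
  mumfordTateGroup_eq_lefschetzGroup_of_forall_subset AbelianVariety.isSmoothProjective_holds
    (forall_isDivisorGenerated_powSucc_iff.1 h)

/-- `Hg′(A) ≤ S(A)` and `Hg(A) ≤ L(A)` for every complex abelian variety, hypothesis-free
("`L(A) ⊃ Hg(A)`", Milne p. 660). [cite: Milne1999LefschetzClasses, §4 p. 660] -/
theorem _root_.Literature.AlgebraicGeometry.Motives.AbelianVariety.hodgeGroup_le_specialLefschetzGroup :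
    hodgeGroup A.dim A.X ≤ specialLefschetzGroup A.dim A.X ∧
      mumfordTateGroup A.dim A.X ≤ lefschetzGroup A.dim A.X :=
  ⟨Milne1999.hodgeGroup_le_specialLefschetzGroup AbelianVariety.isSmoothProjective_holds,
    Milne1999.mumfordTateGroup_le_lefschetzGroup AbelianVariety.isSmoothProjective_holds⟩

/-- An abelian variety WITH an exotic Hodge class on some power has `Hg′(A) ≠ S(A)` as soon as the
record holds and the class lives on `A` itself (contrapositive of (c) ⇒ (a); Milne Remark 4.9: type
III factors, and the general Weil-type varieties of the barrier `Weil1977_exceptionalHodgeClasses`).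
[cite: Milne1999LefschetzClasses, Prop. 4.8 and Remark 4.9 (p. 660)] -/
theorem _root_.Literature.AlgebraicGeometry.Motives.AbelianVariety.hodgeGroup_ne_specialLefschetzGroup_of_not_isDivisorGenerated
    (hrec : Milne1999_specialLefschetzGroup_invariants_le) (hA : ¬ IsDivisorGenerated A) :
    hodgeGroup A.dim A.X ≠ specialLefschetzGroup A.dim A.X :=
  fun h ↦ hA (A.isDivisorGenerated_of_hodgeGroup_eq_specialLefschetzGroup hrec h)

/-- **Milne Prop. 4.8, (b) ⟺ (c), for a complex abelian variety of positive dimension**: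
`Hg′(A) = S(A) ⟺ Hg(A) = L(A)`. [cite: Milne1999LefschetzClasses, Prop. 4.8 (p. 660)] -/
theorem _root_.Literature.AlgebraicGeometry.Motives.AbelianVariety.hodgeGroup_eq_specialLefschetzGroup_iff
    (hA : 1 ≤ A.dim) :
    hodgeGroup A.dim A.X = specialLefschetzGroup A.dim A.X ↔
      mumfordTateGroup A.dim A.X = lefschetzGroup A.dim A.X :=
  Milne1999.hodgeGroup_eq_specialLefschetzGroup_iff AbelianVariety.isSmoothProjective_holds hA

end AbelianVariety

end Literature.AlgebraicGeometry.Milne1999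

end
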